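import Summits.NavierStokesRegularity.NavierStokesRegularity.Theorems.ExtremiserTransienceBangBangCoreDefs
import Summits.NavierStokesRegularity.NavierStokesRegularity.Theorems.ExtremiserTransienceRegularisedNearPlateauStabilityBangBangCoreSlackFermat
import HarnessLib

/-!
# Route `ExtremiserTransience`, crux `RegularisedNearPlateauStability` (stmt-NavierStokesRegularity-28317),
# LINE g8-α «sparse bang-bang»: THE GLOBAL SLACK FIRST VARIATION ALONG A SHRINKING DIRECTION

`--supports stmt-NavierStokesRegularity-28317` (helper). Author: prover seat `ns-net-p2` (g2).

The analytic core (P3) of the global bang-bang inequality (★) of `Cruxes/NearExtremalTransiencePerFlow/Lines/sparse_bangbang.lean`,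
in the form the assembly actually uses.  Let `v` be admissible and `(κ⋆−ε)`-efficient at height `M`, and let
`φ ∈ C_c^∞` be divergence free and TWO-SIDED SHRINKING-ADMISSIBLE: `‖v + σφ‖ ≤ (1−σ)·M` for `|σ| ≤ σ₀` (the direction
`φ = −curl(ζψ̂)` of the line has this property: on the near-top plateau `v + σφ = (1−σ)v`, elsewhere `‖v‖ ≤ (1−δ/2)M`
absorbs `σφ`).  Universality of `κ⋆` (`sharpDepletion_is_universal`) on the admissible fields `v + σφ` (`admissible_add_smul`)
with the bound `(1−σ)M`, and the three expansions `integral_*_add_smul`, say that the SHRINKING SEXTIC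
`F(σ) = (J+σJ₁+σ²J₂+σ³J₃)² − κ⋆²(1−σ)²M²(Z+2σa₁+σ²a₂)(W+2σc₁+σ²c₂)` is `≤ 0` on `[−σ₀, σ₀]`, while near-efficiency gives
`F(0) ≥ −2κ⋆ε·M²ZW`.  Its linear coefficient is `F'(0) = ell_v(φ) + 2κ⋆²M²ZW` (the extra `+2κ⋆²M²ZW` is the gift of the
shrinking bound, `m = −1` in the tree's `firstVariation_le_of_oneSided_normBound`).  With the sizes `|J₁|,|J₂|,|J₃| ≤ b·U`
(`U = M√Z√W`), `|a₁| ≤ ΛZ`, `a₂ ≤ Λ²Z`, `|c₁| ≤ ΛW`, `c₂ ≤ Λ²W` the remainder is `≤ 70 b²Λ⁴U²σ²`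
(`abs_shrinkSextic_remainder_le`, pure algebra), and the landed slack Fermat lemma `abs_linear_coeff_le_of_nonpos` yields

  `|ell_v(φ) + 2κ⋆²·M²·Z·W| ≤ 24·b·Λ²·(√ε + ε/σ₀)·M²·Z·W`      (`abs_ell_add_le_of_shrinking`).

Applied to `φ = −curl(ζψ̂)` this is `ell_v(curl(ζψ̂)) ≥ 2κ⋆²M²ZW − slack`, the left inequality of (★).  HONEST FRAMING:
elementary consequences of the definition of `κ⋆`; nothing about Navier–Stokes is proved; no summit is proved by a line. [folklore]
-/

noncomputable section

open MeasureTheory Set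
open scoped InnerProductSpace RealInnerProductSpace ENNReal ContDiff
open Literature.Analysis.FluidPDE
open Summit.NavierStokesRegularity.NavierStokesRegularity.Theorems.DepletionLadder.KStar.HalfSpace

namespace Summit.NavierStokesRegularity.NavierStokesRegularity.Theorems

-- the problem directory repeats the summit name (`NavierStokesRegularity/NavierStokesRegularity`)
set_option linter.dupNamespace false

namespace DepletionLadder.KStar.BangBang

/-- `κ⋆ ≤ 1` (tree: `κ⋆ ≤ (9 + 2√15)/42`). [folklore] -/
theorem kStar_le_one : kStar ≤ 1 := by
  have h : kStar ≤ (9 + 2 * Real.sqrt 15) / 42 := DepletionLadder.sharpDepletion_le_lambSplit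
  have h15 : Real.sqrt 15 ≤ 4 := by
    rw [show (4 : ℝ) = Real.sqrt (4 ^ 2) by rw [Real.sqrt_sq (by norm_num)]]
    exact Real.sqrt_le_sqrt (by norm_num)
  linarith

/-! ## 1. Pure algebra: the remainder of the shrinking sextic beyond its linear part -/

/-- `|σ| ≤ 1`, `|x| ≤ c` ⇒ `|σx| ≤ c`. [folklore] -/
theorem abs_mul_le_of_abs_le_one {σ x c : ℝ} (hσ : |σ| ≤ 1) (hx : |x| ≤ c) : |σ * x| ≤ c := by
  rw [abs_mul]
  calc |σ| * |x| ≤ 1 * c := mul_le_mul hσ hx (abs_nonneg _) zero_le_one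
    _ = c := one_mul _

/-- Tails of the cubic `J + σJ₁ + σ²J₂ + σ³J₃` for `|σ| ≤ 1`. [folklore] -/
theorem abs_cubicTails_le {J₁ J₂ J₃ U b σ : ℝ} (hJ1 : |J₁| ≤ b * U) (hJ2 : |J₂| ≤ b * U) (hJ3 : |J₃| ≤ b * U)
    (hσ : |σ| ≤ 1) : |J₁ + σ * J₂ + σ ^ 2 * J₃| ≤ 3 * b * U ∧ |J₂ + σ * J₃| ≤ 2 * b * U := by
  have hσ2 : |σ ^ 2| ≤ 1 := by rw [abs_pow]; exact pow_le_one₀ (abs_nonneg _) hσ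
  have h1 := abs_mul_le_of_abs_le_one hσ hJ2
  have h2 := abs_mul_le_of_abs_le_one hσ2 hJ3; have h3 := abs_mul_le_of_abs_le_one hσ hJ3
  constructor
  · calc |J₁ + σ * J₂ + σ ^ 2 * J₃| ≤ |J₁ + σ * J₂| + |σ ^ 2 * J₃| := abs_add_le _ _
      _ ≤ |J₁| + |σ * J₂| + |σ ^ 2 * J₃| := by linarith [abs_add_le J₁ (σ * J₂)]
      _ ≤ 3 * b * U := by linarith
  · calc |J₂ + σ * J₃| ≤ |J₂| + |σ * J₃| := abs_add_le _ _
      _ ≤ 2 * b * U := by linarith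

/-- The `J`-part of the remainder: `|2J(J₂+σJ₃) + (J₁+σJ₂+σ²J₃)²| ≤ 13 b² U²`. [folklore] -/
theorem abs_jPart_le {J J₁ J₂ J₃ U b σ : ℝ} (hb : 1 ≤ b) (hU : 0 ≤ U) (hJ : |J| ≤ U) (hJ1 : |J₁| ≤ b * U)
    (hJ2 : |J₂| ≤ b * U) (hJ3 : |J₃| ≤ b * U) (hσ : |σ| ≤ 1) :
    |2 * J * (J₂ + σ * J₃) + (J₁ + σ * J₂ + σ ^ 2 * J₃) ^ 2| ≤ 13 * b ^ 2 * U ^ 2 := by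
  obtain ⟨hQ, hT⟩ := abs_cubicTails_le hJ1 hJ2 hJ3 hσ
  have h1 : |2 * J * (J₂ + σ * J₃)| ≤ 4 * b * U ^ 2 := by
    rw [abs_mul, abs_mul, abs_two]
    calc 2 * |J| * |J₂ + σ * J₃| ≤ 2 * U * (2 * b * U) := by gcongr
      _ = 4 * b * U ^ 2 := by ring
  have h2 : |(J₁ + σ * J₂ + σ ^ 2 * J₃) ^ 2| ≤ 9 * b ^ 2 * U ^ 2 := by
    rw [abs_pow]
    calc |J₁ + σ * J₂ + σ ^ 2 * J₃| ^ 2 ≤ (3 * b * U) ^ 2 := pow_le_pow_left₀ (abs_nonneg _) hQ 2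
      _ = 9 * b ^ 2 * U ^ 2 := by ring
  have hbb : b ≤ b ^ 2 := by nlinarith
  have hbU : b * U ^ 2 ≤ b ^ 2 * U ^ 2 := mul_le_mul_of_nonneg_right hbb (sq_nonneg U)
  calc |2 * J * (J₂ + σ * J₃) + (J₁ + σ * J₂ + σ ^ 2 * J₃) ^ 2|
      ≤ |2 * J * (J₂ + σ * J₃)| + |(J₁ + σ * J₂ + σ ^ 2 * J₃) ^ 2| := abs_add_le _ _
    _ ≤ 4 * b * U ^ 2 + 9 * b ^ 2 * U ^ 2 := by linarith
    _ ≤ 13 * b ^ 2 * U ^ 2 := by linarith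

/-- The `ZW`-part of the remainder: with `α₁ = σ − 2`, `β₁ = 2a₁ + σa₂`, `γ₁ = 2c₁ + σc₂`,
`|(ZW + a₂W + c₂Z) + α₁(β₁W + Zγ₁) + β₁γ₁(1 + σα₁)| ≤ 57 Λ⁴ ZW`. [folklore] -/
theorem abs_zwPart_le {Z a₁ a₂ W c₁ c₂ Λ σ : ℝ} (hΛ : 1 ≤ Λ) (hZ : 0 ≤ Z) (hW : 0 ≤ W)
    (ha1 : |a₁| ≤ Λ * Z) (ha2 : |a₂| ≤ Λ ^ 2 * Z) (hc1 : |c₁| ≤ Λ * W) (hc2 : |c₂| ≤ Λ ^ 2 * W) (hσ : |σ| ≤ 1) :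
    |(Z * W + a₂ * W + c₂ * Z) + (σ - 2) * ((2 * a₁ + σ * a₂) * W + Z * (2 * c₁ + σ * c₂)) +
        (2 * a₁ + σ * a₂) * (2 * c₁ + σ * c₂) * (1 + σ * (σ - 2))| ≤ 57 * Λ ^ 4 * (Z * W) := by
  have hΛ1 : 1 ≤ Λ ^ 2 := one_le_pow₀ hΛ
  have hΛ2 : Λ ≤ Λ ^ 2 := by nlinarith
  have hΛ22 : Λ ^ 2 ≤ Λ ^ 4 := by nlinarith
  have hZW : 0 ≤ Z * W := mul_nonneg hZ hW
  have hα : |σ - 2| ≤ 3 := by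
    calc |σ - 2| ≤ |σ| + |(2 : ℝ)| := abs_sub _ _
      _ ≤ 3 := by rw [abs_two]; linarith
  have hσα : |1 + σ * (σ - 2)| ≤ 4 := by
    calc |1 + σ * (σ - 2)| ≤ |(1 : ℝ)| + |σ * (σ - 2)| := abs_add_le _ _
      _ = 1 + |σ| * |σ - 2| := by rw [abs_one, abs_mul]
      _ ≤ 1 + 1 * 3 := by gcongr
      _ = 4 := by norm_num
  have hβ : |2 * a₁ + σ * a₂| ≤ 3 * Λ ^ 2 * Z := by
    have h1 : |σ * a₂| ≤ Λ ^ 2 * Z := abs_mul_le_of_abs_le_one hσ ha2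
    have hΛZ : Λ * Z ≤ Λ ^ 2 * Z := mul_le_mul_of_nonneg_right hΛ2 hZ
    calc |2 * a₁ + σ * a₂| ≤ |2 * a₁| + |σ * a₂| := abs_add_le _ _
      _ = 2 * |a₁| + |σ * a₂| := by rw [abs_mul, abs_two]
      _ ≤ 2 * (Λ * Z) + Λ ^ 2 * Z := by linarith
      _ ≤ 3 * Λ ^ 2 * Z := by linarith
  have hγ : |2 * c₁ + σ * c₂| ≤ 3 * Λ ^ 2 * W := by
    have h1 : |σ * c₂| ≤ Λ ^ 2 * W := abs_mul_le_of_abs_le_one hσ hc2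
    have hΛW : Λ * W ≤ Λ ^ 2 * W := mul_le_mul_of_nonneg_right hΛ2 hW
    calc |2 * c₁ + σ * c₂| ≤ |2 * c₁| + |σ * c₂| := abs_add_le _ _
      _ = 2 * |c₁| + |σ * c₂| := by rw [abs_mul, abs_two]
      _ ≤ 2 * (Λ * W) + Λ ^ 2 * W := by linarith
      _ ≤ 3 * Λ ^ 2 * W := by linarith
  have h0 : |Z * W + a₂ * W + c₂ * Z| ≤ 3 * Λ ^ 2 * (Z * W) := by
    have e1 : |a₂ * W| ≤ Λ ^ 2 * (Z * W) := by
      rw [abs_mul, abs_of_nonneg hW]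
      calc |a₂| * W ≤ Λ ^ 2 * Z * W := mul_le_mul_of_nonneg_right ha2 hW
        _ = Λ ^ 2 * (Z * W) := by ring
    have e2 : |c₂ * Z| ≤ Λ ^ 2 * (Z * W) := by
      rw [abs_mul, abs_of_nonneg hZ]
      calc |c₂| * Z ≤ Λ ^ 2 * W * Z := mul_le_mul_of_nonneg_right hc2 hZ
        _ = Λ ^ 2 * (Z * W) := by ring
    have e3 : |Z * W| ≤ Λ ^ 2 * (Z * W) := by
      rw [abs_of_nonneg hZW]; exact le_mul_of_one_le_left hZW hΛ1
    calc |Z * W + a₂ * W + c₂ * Z| ≤ |Z * W + a₂ * W| + |c₂ * Z| := abs_add_le _ _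
      _ ≤ |Z * W| + |a₂ * W| + |c₂ * Z| := by linarith [abs_add_le (Z * W) (a₂ * W)]
      _ ≤ 3 * Λ ^ 2 * (Z * W) := by linarith
  have h1 : |(σ - 2) * ((2 * a₁ + σ * a₂) * W + Z * (2 * c₁ + σ * c₂))| ≤ 18 * Λ ^ 2 * (Z * W) := by
    have e1 : |(2 * a₁ + σ * a₂) * W| ≤ 3 * Λ ^ 2 * (Z * W) := by
      rw [abs_mul, abs_of_nonneg hW]
      calc |2 * a₁ + σ * a₂| * W ≤ 3 * Λ ^ 2 * Z * W := mul_le_mul_of_nonneg_right hβ hW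
        _ = 3 * Λ ^ 2 * (Z * W) := by ring
    have e2 : |Z * (2 * c₁ + σ * c₂)| ≤ 3 * Λ ^ 2 * (Z * W) := by
      rw [abs_mul, abs_of_nonneg hZ]
      calc Z * |2 * c₁ + σ * c₂| ≤ Z * (3 * Λ ^ 2 * W) := mul_le_mul_of_nonneg_left hγ hZ
        _ = 3 * Λ ^ 2 * (Z * W) := by ring
    have e3 : |(2 * a₁ + σ * a₂) * W + Z * (2 * c₁ + σ * c₂)| ≤ 6 * Λ ^ 2 * (Z * W) := by
      calc |(2 * a₁ + σ * a₂) * W + Z * (2 * c₁ + σ * c₂)|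
          ≤ |(2 * a₁ + σ * a₂) * W| + |Z * (2 * c₁ + σ * c₂)| := abs_add_le _ _
        _ ≤ 6 * Λ ^ 2 * (Z * W) := by linarith
    rw [abs_mul]
    calc |σ - 2| * |(2 * a₁ + σ * a₂) * W + Z * (2 * c₁ + σ * c₂)| ≤ 3 * (6 * Λ ^ 2 * (Z * W)) :=
          mul_le_mul hα e3 (abs_nonneg _) (by norm_num)
      _ = 18 * Λ ^ 2 * (Z * W) := by ring
  have h2 : |(2 * a₁ + σ * a₂) * (2 * c₁ + σ * c₂) * (1 + σ * (σ - 2))| ≤ 36 * Λ ^ 4 * (Z * W) := by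
    have e1 : |2 * a₁ + σ * a₂| * |2 * c₁ + σ * c₂| ≤ (3 * Λ ^ 2 * Z) * (3 * Λ ^ 2 * W) :=
      mul_le_mul hβ hγ (abs_nonneg _) (by positivity)
    rw [abs_mul, abs_mul]
    calc |2 * a₁ + σ * a₂| * |2 * c₁ + σ * c₂| * |1 + σ * (σ - 2)| ≤ (3 * Λ ^ 2 * Z) * (3 * Λ ^ 2 * W) * 4 :=
          mul_le_mul e1 hσα (abs_nonneg _) (by positivity)
      _ = 36 * Λ ^ 4 * (Z * W) := by ring
  have h24 : Λ ^ 2 * (Z * W) ≤ Λ ^ 4 * (Z * W) := mul_le_mul_of_nonneg_right hΛ22 hZW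
  calc |(Z * W + a₂ * W + c₂ * Z) + (σ - 2) * ((2 * a₁ + σ * a₂) * W + Z * (2 * c₁ + σ * c₂)) +
        (2 * a₁ + σ * a₂) * (2 * c₁ + σ * c₂) * (1 + σ * (σ - 2))|
      ≤ |(Z * W + a₂ * W + c₂ * Z) + (σ - 2) * ((2 * a₁ + σ * a₂) * W + Z * (2 * c₁ + σ * c₂))| +
        |(2 * a₁ + σ * a₂) * (2 * c₁ + σ * c₂) * (1 + σ * (σ - 2))| := abs_add_le _ _
    _ ≤ |Z * W + a₂ * W + c₂ * Z| + |(σ - 2) * ((2 * a₁ + σ * a₂) * W + Z * (2 * c₁ + σ * c₂))| +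
        |(2 * a₁ + σ * a₂) * (2 * c₁ + σ * c₂) * (1 + σ * (σ - 2))| := by
        linarith [abs_add_le (Z * W + a₂ * W + c₂ * Z)
          ((σ - 2) * ((2 * a₁ + σ * a₂) * W + Z * (2 * c₁ + σ * c₂)))]
    _ ≤ 3 * Λ ^ 2 * (Z * W) + 18 * Λ ^ 2 * (Z * W) + 36 * Λ ^ 4 * (Z * W) := by linarith
    _ ≤ 57 * Λ ^ 4 * (Z * W) := by linarith

/-- The algebraic identity behind the remainder: the shrinking sextic minus its constant and linear parts. [folklore] -/
theorem shrinkSextic_sub_eq (J J₁ J₂ J₃ K M Z a₁ a₂ W c₁ c₂ σ : ℝ) :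
    ((J + σ * J₁ + σ ^ 2 * J₂ + σ ^ 3 * J₃) ^ 2 -
        K ^ 2 * ((1 + (-1) * σ) * M) ^ 2 * (Z + 2 * σ * a₁ + σ ^ 2 * a₂) * (W + 2 * σ * c₁ + σ ^ 2 * c₂))
      - (J ^ 2 - K ^ 2 * M ^ 2 * Z * W)
      - (2 * J * J₁ - K ^ 2 * M ^ 2 * (-2 * Z * W + 2 * a₁ * W + 2 * Z * c₁)) * σ =
    σ ^ 2 * (2 * J * (J₂ + σ * J₃) + (J₁ + σ * J₂ + σ ^ 2 * J₃) ^ 2) -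
      K ^ 2 * M ^ 2 * σ ^ 2 * ((Z * W + a₂ * W + c₂ * Z) +
        (σ - 2) * ((2 * a₁ + σ * a₂) * W + Z * (2 * c₁ + σ * c₂)) +
        (2 * a₁ + σ * a₂) * (2 * c₁ + σ * c₂) * (1 + σ * (σ - 2))) := by
  ring

/-- **Remainder of the shrinking sextic.** For `|σ| ≤ 1`, sizes `|J| ≤ U`, `|J₁|,|J₂|,|J₃| ≤ bU`, `|a₁| ≤ ΛZ`,
`|a₂| ≤ Λ²Z`, `|c₁| ≤ ΛW`, `|c₂| ≤ Λ²W` (`b, Λ ≥ 1`, `U² = M²ZW`, `0 ≤ K ≤ 1`):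
`|F(σ) − F(0) − F'(0)σ| ≤ 70·b²·Λ⁴·U²·σ²` for
`F(σ) = (J+σJ₁+σ²J₂+σ³J₃)² − K²((1−σ)M)²(Z+2σa₁+σ²a₂)(W+2σc₁+σ²c₂)`. [folklore] -/
theorem abs_shrinkSextic_remainder_le {J J₁ J₂ J₃ K M Z a₁ a₂ W c₁ c₂ U b Λ σ : ℝ}
    (hK0 : 0 ≤ K) (hK1 : K ≤ 1) (hb : 1 ≤ b) (hΛ : 1 ≤ Λ) (hZ : 0 ≤ Z) (hW : 0 ≤ W) (hU : 0 ≤ U)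
    (hU2 : U ^ 2 = M ^ 2 * Z * W)
    (hJ : |J| ≤ U) (hJ1 : |J₁| ≤ b * U) (hJ2 : |J₂| ≤ b * U) (hJ3 : |J₃| ≤ b * U)
    (ha1 : |a₁| ≤ Λ * Z) (ha2 : |a₂| ≤ Λ ^ 2 * Z) (hc1 : |c₁| ≤ Λ * W) (hc2 : |c₂| ≤ Λ ^ 2 * W)
    (hσ : |σ| ≤ 1) :
    |((J + σ * J₁ + σ ^ 2 * J₂ + σ ^ 3 * J₃) ^ 2 -
        K ^ 2 * ((1 + (-1) * σ) * M) ^ 2 * (Z + 2 * σ * a₁ + σ ^ 2 * a₂) * (W + 2 * σ * c₁ + σ ^ 2 * c₂))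
      - (J ^ 2 - K ^ 2 * M ^ 2 * Z * W)
      - (2 * J * J₁ - K ^ 2 * M ^ 2 * (-2 * Z * W + 2 * a₁ * W + 2 * Z * c₁)) * σ|
    ≤ 70 * b ^ 2 * Λ ^ 4 * U ^ 2 * σ ^ 2 := by
  rw [shrinkSextic_sub_eq]
  have hA := abs_jPart_le hb hU hJ hJ1 hJ2 hJ3 hσ
  have hB := abs_zwPart_le hΛ hZ hW ha1 ha2 hc1 hc2 hσ
  have hK2 : K ^ 2 ≤ 1 := pow_le_one₀ hK0 hK1
  have hb2 : 1 ≤ b ^ 2 := one_le_pow₀ hb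
  have hΛ4 : 1 ≤ Λ ^ 4 := one_le_pow₀ hΛ
  have hU20 : 0 ≤ U ^ 2 := sq_nonneg U
  have hσ2 : 0 ≤ σ ^ 2 := sq_nonneg σ
  have hA' : |σ ^ 2 * (2 * J * (J₂ + σ * J₃) + (J₁ + σ * J₂ + σ ^ 2 * J₃) ^ 2)| ≤
      σ ^ 2 * (13 * b ^ 2 * U ^ 2) := by
    rw [abs_mul, abs_of_nonneg hσ2]
    exact mul_le_mul_of_nonneg_left hA hσ2
  have hB' : |K ^ 2 * M ^ 2 * σ ^ 2 * ((Z * W + a₂ * W + c₂ * Z) +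
        (σ - 2) * ((2 * a₁ + σ * a₂) * W + Z * (2 * c₁ + σ * c₂)) +
        (2 * a₁ + σ * a₂) * (2 * c₁ + σ * c₂) * (1 + σ * (σ - 2)))| ≤ σ ^ 2 * (57 * Λ ^ 4 * U ^ 2) := by
    rw [abs_mul, abs_mul, abs_mul, abs_of_nonneg (sq_nonneg K), abs_of_nonneg (sq_nonneg M), abs_of_nonneg hσ2]
    calc K ^ 2 * M ^ 2 * σ ^ 2 * |(Z * W + a₂ * W + c₂ * Z) +
          (σ - 2) * ((2 * a₁ + σ * a₂) * W + Z * (2 * c₁ + σ * c₂)) +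
          (2 * a₁ + σ * a₂) * (2 * c₁ + σ * c₂) * (1 + σ * (σ - 2))|
        ≤ 1 * M ^ 2 * σ ^ 2 * (57 * Λ ^ 4 * (Z * W)) := by gcongr
      _ = σ ^ 2 * (57 * Λ ^ 4 * (M ^ 2 * Z * W)) := by ring
      _ = σ ^ 2 * (57 * Λ ^ 4 * U ^ 2) := by rw [hU2]
  have e1 : 13 * b ^ 2 * U ^ 2 ≤ 13 * b ^ 2 * Λ ^ 4 * U ^ 2 := by
    have h := mul_le_mul_of_nonneg_left hΛ4 (mul_nonneg (by positivity : (0 : ℝ) ≤ 13 * b ^ 2) hU20)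
    nlinarith
  have e2 : 57 * Λ ^ 4 * U ^ 2 ≤ 57 * b ^ 2 * Λ ^ 4 * U ^ 2 := by
    have h := mul_le_mul_of_nonneg_left hb2 (mul_nonneg (by positivity : (0 : ℝ) ≤ 57 * Λ ^ 4) hU20)
    nlinarith
  calc |σ ^ 2 * (2 * J * (J₂ + σ * J₃) + (J₁ + σ * J₂ + σ ^ 2 * J₃) ^ 2) -
        K ^ 2 * M ^ 2 * σ ^ 2 * ((Z * W + a₂ * W + c₂ * Z) +
          (σ - 2) * ((2 * a₁ + σ * a₂) * W + Z * (2 * c₁ + σ * c₂)) +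
          (2 * a₁ + σ * a₂) * (2 * c₁ + σ * c₂) * (1 + σ * (σ - 2)))|
      ≤ |σ ^ 2 * (2 * J * (J₂ + σ * J₃) + (J₁ + σ * J₂ + σ ^ 2 * J₃) ^ 2)| +
        |K ^ 2 * M ^ 2 * σ ^ 2 * ((Z * W + a₂ * W + c₂ * Z) +
          (σ - 2) * ((2 * a₁ + σ * a₂) * W + Z * (2 * c₁ + σ * c₂)) +
          (2 * a₁ + σ * a₂) * (2 * c₁ + σ * c₂) * (1 + σ * (σ - 2)))| := abs_sub _ _
    _ ≤ σ ^ 2 * (13 * b ^ 2 * U ^ 2) + σ ^ 2 * (57 * Λ ^ 4 * U ^ 2) := by linarith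
    _ ≤ σ ^ 2 * (13 * b ^ 2 * Λ ^ 4 * U ^ 2) + σ ^ 2 * (57 * b ^ 2 * Λ ^ 4 * U ^ 2) := by
        gcongr
    _ = 70 * b ^ 2 * Λ ^ 4 * U ^ 2 * σ ^ 2 := by ring

/-! ## 2. The slack first variation along a shrinking direction -/

/-- Numerics of the slack: `2√(2κε U²·70b²Λ⁴U²) + 2·(2κεU²)/σ₀ ≤ 24·b·Λ²·(√ε + ε/σ₀)·U²` for `0 ≤ κ ≤ 1`,
`b, Λ ≥ 1`. [folklore] -/
theorem slack_numerics_le {K ε σ₀ b Λ U : ℝ} (hK1 : K ≤ 1) (hb : 1 ≤ b) (hΛ : 1 ≤ Λ) (hε : 0 ≤ ε)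
    (hσ₀ : 0 < σ₀) :
    2 * Real.sqrt (2 * K * ε * U ^ 2 * (70 * b ^ 2 * Λ ^ 4 * U ^ 2)) + 2 * (2 * K * ε * U ^ 2) / σ₀ ≤
      24 * b * Λ ^ 2 * (Real.sqrt ε + ε / σ₀) * U ^ 2 := by
  have hb0 : 0 ≤ b := le_trans zero_le_one hb
  have hΛ0 : 0 ≤ Λ := le_trans zero_le_one hΛ
  have hΛ2 : 1 ≤ Λ ^ 2 := one_le_pow₀ hΛ
  have hcoef0 : 0 ≤ 12 * b * Λ ^ 2 * Real.sqrt ε * U ^ 2 :=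
    mul_nonneg (mul_nonneg (mul_nonneg (mul_nonneg (by norm_num) hb0) (pow_nonneg hΛ0 2)) (Real.sqrt_nonneg _))
      (sq_nonneg U)
  have hsqrt : Real.sqrt (2 * K * ε * U ^ 2 * (70 * b ^ 2 * Λ ^ 4 * U ^ 2)) ≤
      12 * b * Λ ^ 2 * Real.sqrt ε * U ^ 2 := by
    have hx : 2 * K * ε * U ^ 2 * (70 * b ^ 2 * Λ ^ 4 * U ^ 2) ≤ (12 * b * Λ ^ 2 * Real.sqrt ε * U ^ 2) ^ 2 := by
      have hε2 : Real.sqrt ε ^ 2 = ε := Real.sq_sqrt hε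
      have e : (12 * b * Λ ^ 2 * Real.sqrt ε * U ^ 2) ^ 2 = 144 * (ε * b ^ 2 * Λ ^ 4 * (U ^ 2) ^ 2) := by
        rw [show (12 * b * Λ ^ 2 * Real.sqrt ε * U ^ 2) ^ 2 =
          144 * Real.sqrt ε ^ 2 * b ^ 2 * (Λ ^ 2) ^ 2 * (U ^ 2) ^ 2 by ring, hε2]; ring
      have e' : 2 * K * ε * U ^ 2 * (70 * b ^ 2 * Λ ^ 4 * U ^ 2) = (140 * K) * (ε * b ^ 2 * Λ ^ 4 * (U ^ 2) ^ 2) := by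
        ring
      rw [e, e']
      have hpos : 0 ≤ ε * b ^ 2 * Λ ^ 4 * (U ^ 2) ^ 2 := by positivity
      exact mul_le_mul_of_nonneg_right (by linarith) hpos
    calc Real.sqrt (2 * K * ε * U ^ 2 * (70 * b ^ 2 * Λ ^ 4 * U ^ 2))
        ≤ Real.sqrt ((12 * b * Λ ^ 2 * Real.sqrt ε * U ^ 2) ^ 2) := Real.sqrt_le_sqrt hx
      _ = 12 * b * Λ ^ 2 * Real.sqrt ε * U ^ 2 := Real.sqrt_sq hcoef0
  have hlin2 : 2 * (2 * K * ε * U ^ 2) / σ₀ ≤ 24 * b * Λ ^ 2 * (ε / σ₀) * U ^ 2 := by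
    rw [show 2 * (2 * K * ε * U ^ 2) / σ₀ = (4 * K) * ((ε / σ₀) * U ^ 2) by ring,
      show 24 * b * Λ ^ 2 * (ε / σ₀) * U ^ 2 = (24 * (b * Λ ^ 2)) * ((ε / σ₀) * U ^ 2) by ring]
    have hεσ : 0 ≤ (ε / σ₀) * U ^ 2 := mul_nonneg (div_nonneg hε hσ₀.le) (sq_nonneg U)
    have hbΛ : 1 ≤ b * Λ ^ 2 := one_le_mul_of_one_le_of_one_le hb hΛ2
    exact mul_le_mul_of_nonneg_right (by linarith) hεσ
  calc 2 * Real.sqrt (2 * K * ε * U ^ 2 * (70 * b ^ 2 * Λ ^ 4 * U ^ 2)) + 2 * (2 * K * ε * U ^ 2) / σ₀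
      ≤ 2 * (12 * b * Λ ^ 2 * Real.sqrt ε * U ^ 2) + 24 * b * Λ ^ 2 * (ε / σ₀) * U ^ 2 := by linarith
    _ = 24 * b * Λ ^ 2 * (Real.sqrt ε + ε / σ₀) * U ^ 2 := by ring

variable {v φ : E3 → E3}

/-- The mixed stretching coefficient `J₂` of the expansion `J(v+σφ) = J + σJ₁ + σ²J₂ + σ³J₃` is `J1 φ v`. [folklore] -/
theorem integral_J2_eq_J1 (v φ : E3 → E3) :
    (∫ x, (⟪curl φ x, fderiv ℝ φ x (curl v x)⟫ + ⟪curl φ x, fderiv ℝ v x (curl φ x)⟫ +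
      ⟪curl v x, fderiv ℝ φ x (curl φ x)⟫)) = J1 φ v := by
  simp only [J1]
  refine integral_congr_ae (Filter.Eventually.of_forall fun x => ?_)
  ring

/-- **THE GLOBAL SLACK FIRST VARIATION ALONG A SHRINKING DIRECTION.** Let `v` be admissible and `(κ⋆−ε)`-efficient at
height `M` (`0 ≤ ε ≤ κ⋆`), and let `φ ∈ C_c^∞` be divergence free with `‖v + σφ‖ ≤ (1−σ)M` for all `|σ| ≤ σ₀`
(`0 < σ₀ ≤ 1`).  If `|J₁(φ)|, |J₁(φ;v)|, |J(φ)| ≤ b·M√Z√W`, `|a₁(φ)| ≤ ΛZ`, `Z(φ) ≤ Λ²Z`, `|c₁(φ)| ≤ ΛW`, `W(φ) ≤ Λ²W`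
(`b, Λ ≥ 1`), then `|ell_v(φ) + 2κ⋆²M²ZW| ≤ 24·b·Λ²·(√ε + ε/σ₀)·M²ZW`. [folklore] -/
theorem abs_ell_add_le_of_shrinking {M B ε σ₀ b Λ : ℝ} (hadm : IsAdm v M B) (hφ : ContDiff ℝ ∞ φ)
    (hφc : HasCompactSupport φ) (hφdiv : VectorCalculus.IsDivFree φ) (hσ₀ : 0 < σ₀) (hσ₁ : σ₀ ≤ 1)
    (hbound : ∀ σ : ℝ, |σ| ≤ σ₀ → ∀ x, ‖v x + σ • φ x‖ ≤ (1 - σ) * M)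
    (hε : 0 ≤ ε) (hεk : ε ≤ kStar)
    (heff : (kStar - ε) * M * Real.sqrt (Zen v) * Real.sqrt (Wpa v) ≤ |Jst v|) (hb : 1 ≤ b) (hΛ : 1 ≤ Λ)
    (hJ1 : |J1 v φ| ≤ b * (M * Real.sqrt (Zen v) * Real.sqrt (Wpa v)))
    (hJ2 : |J1 φ v| ≤ b * (M * Real.sqrt (Zen v) * Real.sqrt (Wpa v)))
    (hJ3 : |Jst φ| ≤ b * (M * Real.sqrt (Zen v) * Real.sqrt (Wpa v)))
    (ha1 : |A1 v φ| ≤ Λ * Zen v) (ha2 : Zen φ ≤ Λ ^ 2 * Zen v)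
    (hc1 : |C1 v φ| ≤ Λ * Wpa v) (hc2 : Wpa φ ≤ Λ ^ 2 * Wpa v) :
    |ell v M φ + 2 * kStar ^ 2 * M ^ 2 * Zen v * Wpa v| ≤
      24 * b * Λ ^ 2 * (Real.sqrt ε + ε / σ₀) * (M ^ 2 * Zen v * Wpa v) := by
  obtain ⟨hv, hdiv, hM, hB, h0, h1, h2⟩ := hadm
  have hK0 : 0 ≤ kStar := kStar_pos.le
  have hK1 : kStar ≤ 1 := kStar_le_one
  have hM0 : 0 ≤ M := (norm_nonneg _).trans (hM 0)
  have hZ0 : 0 ≤ Zen v := integral_nonneg fun x => sq_nonneg _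
  have hW0 : 0 ≤ Wpa v := integral_nonneg fun x => frobeniusNormSq_nonneg _
  have hZφ0 : 0 ≤ Zen φ := integral_nonneg fun x => sq_nonneg _
  have hWφ0 : 0 ≤ Wpa φ := integral_nonneg fun x => frobeniusNormSq_nonneg _
  have hb0 : 0 ≤ b := le_trans zero_le_one hb
  have hΛ0 : 0 ≤ Λ := le_trans zero_le_one hΛ
  set U : ℝ := M * Real.sqrt (Zen v) * Real.sqrt (Wpa v) with hUdef
  have hU0 : 0 ≤ U := by rw [hUdef]; positivity
  have hU2 : U ^ 2 = M ^ 2 * Zen v * Wpa v := by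
    rw [hUdef, mul_pow, mul_pow, Real.sq_sqrt hZ0, Real.sq_sqrt hW0]
  -- `|J| ≤ κ⋆ U ≤ U`
  have hJK : |Jst v| ≤ kStar * M * Real.sqrt (Zen v) * Real.sqrt (Wpa v) :=
    DepletionLadder.sharpDepletion_is_universal v M B hv hdiv hM hB h0 h1 h2
  have hJU : |Jst v| ≤ U := by
    have h1' : kStar * M * Real.sqrt (Zen v) * Real.sqrt (Wpa v) = kStar * U := by rw [hUdef]; ring
    rw [h1'] at hJK
    exact hJK.trans (mul_le_of_le_one_left hU0 hK1)
  -- `F(0) ≥ −2κ⋆εU²`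
  have hc0 : -(2 * kStar * ε * U ^ 2) ≤ Jst v ^ 2 - kStar ^ 2 * M ^ 2 * Zen v * Wpa v := by
    have hkε : 0 ≤ (kStar - ε) * U := mul_nonneg (by linarith) hU0
    have heff' : (kStar - ε) * U ≤ |Jst v| := by
      have e : (kStar - ε) * M * Real.sqrt (Zen v) * Real.sqrt (Wpa v) = (kStar - ε) * U := by rw [hUdef]; ring
      rw [← e]; exact heff
    have hsq : ((kStar - ε) * U) ^ 2 ≤ Jst v ^ 2 := by
      calc ((kStar - ε) * U) ^ 2 ≤ |Jst v| ^ 2 := pow_le_pow_left₀ hkε heff' 2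
        _ = Jst v ^ 2 := sq_abs _
    have e2 : kStar ^ 2 * M ^ 2 * Zen v * Wpa v = kStar ^ 2 * U ^ 2 := by rw [hU2]; ring
    rw [e2]
    nlinarith [mul_nonneg (mul_nonneg hε hε) (sq_nonneg U)]
  -- the shrinking sextic is `≤ 0` on `[-σ₀, σ₀]`
  set p : ℝ → ℝ := fun σ => (Jst v + σ * J1 v φ + σ ^ 2 * J1 φ v + σ ^ 3 * Jst φ) ^ 2 -
    kStar ^ 2 * ((1 + (-1) * σ) * M) ^ 2 * (Zen v + 2 * σ * A1 v φ + σ ^ 2 * Zen φ) *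
      (Wpa v + 2 * σ * C1 v φ + σ ^ 2 * Wpa φ) with hpdef
  have hple : ∀ σ, |σ| ≤ σ₀ → p σ ≤ 0 := by
    intro σ hσ
    obtain ⟨hcd, hdv, ⟨B', hB'⟩, h0', h1', h2'⟩ := admissible_add_smul hv hdiv hB h0 h1 h2 hφ hφc hφdiv σ
    have hbσ : ∀ x, ‖v x + σ • φ x‖ ≤ (1 + (-1) * σ) * M := by
      intro x; have := hbound σ hσ x; linarith
    have hu : |∫ x, ⟪curl (fun y => v y + σ • φ y) x,
        fderiv ℝ (fun y => v y + σ • φ y) x (curl (fun y => v y + σ • φ y) x)⟫| ≤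
        kStar * ((1 + (-1) * σ) * M) * Real.sqrt (∫ x, ‖curl (fun y => v y + σ • φ y) x‖ ^ 2) *
          Real.sqrt (∫ x, frobeniusNormSq (fderiv ℝ (curl (fun y => v y + σ • φ y)) x)) :=
      DepletionLadder.sharpDepletion_is_universal _ ((1 + (-1) * σ) * M) B' hcd hdv hbσ hB' h0' h1' h2'
    have hZσ : 0 ≤ ∫ x, ‖curl (fun y => v y + σ • φ y) x‖ ^ 2 := integral_nonneg fun x => sq_nonneg _
    have hWσ : 0 ≤ ∫ x, frobeniusNormSq (fderiv ℝ (curl (fun y => v y + σ • φ y)) x) :=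
      integral_nonneg fun x => frobeniusNormSq_nonneg _
    have hsq : (∫ x, ⟪curl (fun y => v y + σ • φ y) x,
        fderiv ℝ (fun y => v y + σ • φ y) x (curl (fun y => v y + σ • φ y) x)⟫) ^ 2 ≤
        (kStar * ((1 + (-1) * σ) * M) * Real.sqrt (∫ x, ‖curl (fun y => v y + σ • φ y) x‖ ^ 2) *
          Real.sqrt (∫ x, frobeniusNormSq (fderiv ℝ (curl (fun y => v y + σ • φ y)) x))) ^ 2 := by
      rw [← sq_abs (∫ x, ⟪curl (fun y => v y + σ • φ y) x,
        fderiv ℝ (fun y => v y + σ • φ y) x (curl (fun y => v y + σ • φ y) x)⟫)]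
      exact pow_le_pow_left₀ (abs_nonneg _) hu 2
    rw [mul_pow, mul_pow, mul_pow, Real.sq_sqrt hZσ, Real.sq_sqrt hWσ,
      integral_stretching_add_smul hv hB h1 hφ hφc σ, integral_normSq_curl_add_smul hv h1 hφ hφc σ,
      integral_frobeniusNormSq_add_smul hv h2 hφ hφc σ, integral_J2_eq_J1] at hsq
    have hsq' : (Jst v + σ * J1 v φ + σ ^ 2 * J1 φ v + σ ^ 3 * Jst φ) ^ 2 ≤
        kStar ^ 2 * ((1 + (-1) * σ) * M) ^ 2 * (Zen v + 2 * σ * A1 v φ + σ ^ 2 * Zen φ) *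
          (Wpa v + 2 * σ * C1 v φ + σ ^ 2 * Wpa φ) := hsq
    show (Jst v + σ * J1 v φ + σ ^ 2 * J1 φ v + σ ^ 3 * Jst φ) ^ 2 -
      kStar ^ 2 * ((1 + (-1) * σ) * M) ^ 2 * (Zen v + 2 * σ * A1 v φ + σ ^ 2 * Zen φ) *
        (Wpa v + 2 * σ * C1 v φ + σ ^ 2 * Wpa φ) ≤ 0
    linarith
  -- the remainder bound
  have hrem : ∀ σ, |σ| ≤ σ₀ → |p σ - (Jst v ^ 2 - kStar ^ 2 * M ^ 2 * Zen v * Wpa v) -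
      (2 * Jst v * J1 v φ - kStar ^ 2 * M ^ 2 * (-2 * Zen v * Wpa v + 2 * A1 v φ * Wpa v + 2 * Zen v * C1 v φ)) * σ|
      ≤ 70 * b ^ 2 * Λ ^ 4 * U ^ 2 * σ ^ 2 := by
    intro σ hσ
    exact abs_shrinkSextic_remainder_le hK0 hK1 hb hΛ hZ0 hW0 hU0 hU2 hJU hJ1 hJ2 hJ3 ha1
      (by rw [abs_of_nonneg hZφ0]; exact ha2) hc1 (by rw [abs_of_nonneg hWφ0]; exact hc2) (hσ.trans hσ₁)
  -- slack Fermat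
  have hkey := abs_linear_coeff_le_of_nonpos (p := p) (δ := 2 * kStar * ε * U ^ 2)
    (c₀ := Jst v ^ 2 - kStar ^ 2 * M ^ 2 * Zen v * Wpa v)
    (c₁ := 2 * Jst v * J1 v φ - kStar ^ 2 * M ^ 2 * (-2 * Zen v * Wpa v + 2 * A1 v φ * Wpa v + 2 * Zen v * C1 v φ))
    (S := 70 * b ^ 2 * Λ ^ 4 * U ^ 2) hσ₀ hc0 hrem hple
  -- identify the linear coefficient with `ell + 2κ⋆²M²ZW`
  have hlin : 2 * Jst v * J1 v φ - kStar ^ 2 * M ^ 2 * (-2 * Zen v * Wpa v + 2 * A1 v φ * Wpa v + 2 * Zen v * C1 v φ) =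
      ell v M φ + 2 * kStar ^ 2 * M ^ 2 * Zen v * Wpa v := by
    simp only [ell]; ring
  rw [hlin] at hkey
  refine hkey.trans ?_
  rw [← hU2]
  exact slack_numerics_le hK1 hb hΛ hε hσ₀

end DepletionLadder.KStar.BangBang

end Summit.NavierStokesRegularity.NavierStokesRegularity.Theorems

end
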